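import Mathlib
import HarnessLib
import Literature.AlgebraicGeometry.Resolution.AlterationsResolution
import Summits.ResolutionOfSingularities.ResolutionOfSingularities.Theorems.WildQuotientsWildQuotientResolutionS1aGameFrame

/-!
# S1a — pulled-back sections along a realised move do not vanish (`appLE_top_ne_zero_of_eq_comp_id`)

[OURS · L1 W4.5c · crux stmt-ResolutionOfSingularities-17941 `CyclicQuotientFourfolds`, line `s1a-logminvertex` v13 (`stub_reachLowerInFX`); R4c cusp,
assembly step (b6) of `Cruxes/CyclicQuotientFourfolds/Lines/s1a_logminvertex-R4c-PROGRESS-v2.md`, obligation `hζ : π₁^*ξ_O ≠ 0`] — NOT statements of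
the manuscript; counted 0; AI-level work, weaker than expert review.

The glue step of `cusp_killsIn_two` discharges the overlap hypothesis `hass` of ✓`killsIn_one_of_sectionCharts_of_associated` by
✓`associated_sections_of_mul_pow_eq_global`, which needs the GLOBAL normaliser `ζ = π₁^*ξ_O ∈ Γ(M₁.V, ⊤)` to be non-zero. This file proves the
generic fact behind it: the structure morphism `M.π : M.V ⟶ X′` of a `G`-model is birational, hence dominant, hence (the target being reduced and
`M.π` proper) scheme-theoretically dominant with injective `app`; composed with the injective restriction maps of the integral `M.V` this gives
injectivity of every `appLE` onto a non-empty open, in particular onto `⊤`. Stated for a morphism `π₁` with `M.π = π₁ ≫ 𝟙 X′` — literally the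
second component of `(GModel.initial hq h₀).IsMoveOf M₁ 𝒦 d`.
-/

set_option linter.dupNamespace false

noncomputable section

open CategoryTheory Limits AlgebraicGeometry TopologicalSpace Opposite
open Literature.AlgebraicGeometry.Resolution

namespace Summit.ResolutionOfSingularities.ResolutionOfSingularities.Theorems.WildQuotientResolution.S1.GameFrame.GModel

variable {p : ℕ} {X' X₁ : Scheme.{0}} {q : X' ⟶ X₁} {G : Type} [Group G] {ρ : G →* Aut X'} {g₀ : G}

/-- The structure morphism of a `G`-model onto a reduced `X′` is scheme-theoretically dominant (birational ⇒ dominant ⇒ trivial kernel).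
[OURS · L1 W4.5c · folklore plumbing] -/
theorem isSchemeTheoreticallyDominant_π [IsReduced X'] (M : GModel p q G ρ g₀) : IsSchemeTheoreticallyDominant M.π :=
  haveI : IsDominant M.π := M.isBirational.isDominant
  IsSchemeTheoreticallyDominant.of_isDominant _

/-- Pull-back of sections along the structure morphism of a `G`-model onto a reduced `X′` is injective (Mathlib `Scheme.Hom.app_injective`:
scheme-theoretically dominant + quasi-compact, the latter from properness). [OURS · L1 W4.5c · folklore plumbing] -/
theorem app_π_injective [IsReduced X'] (M : GModel p q G ρ g₀) (U : X'.Opens) : Function.Injective (M.π.app U) :=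
  haveI := M.isSchemeTheoreticallyDominant_π
  haveI : IsProper M.π := M.isProper
  M.π.app_injective U

/-- **`appLE` along a realised move of the initial model is injective onto every non-empty open**: for `π₁ : M.V ⟶ X′` with `M.π = π₁ ≫ 𝟙 X′`
(the shape exported by `GModel.IsMoveOf` from `GModel.initial`), `π₁.appLE U V _ : Γ(X′, U) → Γ(M.V, V)` is injective whenever `V` is non-empty
(`app` injective by `app_π_injective`, restriction injective on the integral `M.V` by Mathlib `map_injective_of_isIntegral`). [OURS · L1 W4.5c] -/
theorem appLE_injective_of_eq_comp_id [IsReduced X'] (M : GModel p q G ρ g₀) {π₁ : M.V ⟶ X'} (hπ : M.π = π₁ ≫ 𝟙 X')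
    (U : X'.Opens) (V : M.V.Opens) (hV : V ≤ π₁ ⁻¹ᵁ U) [Nonempty V] : Function.Injective (π₁.appLE U V hV) := by
  have hπ₁ : π₁ = M.π := by rw [hπ, Category.comp_id]
  subst hπ₁
  haveI := M.isIntegral
  intro a b h
  have h' : (M.V.presheaf.map (homOfLE hV).op) ((M.π.app U) a) = (M.V.presheaf.map (homOfLE hV).op) ((M.π.app U) b) := by
    simpa only [Scheme.Hom.appLE, CommRingCat.comp_apply] using h
  exact M.app_π_injective U (map_injective_of_isIntegral M.V (homOfLE hV) h')

/-- **A non-zero section of `X′` pulls back to a NON-ZERO global section of any realised move of the initial model** (`V = ⊤` is non-empty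
because `M.V` is integral). This is the obligation `hζ : π₁^*ξ ≠ 0` of the R4c cusp assembly (`ξ = 2x₂ − 3x₁² ≠ 0` in `k[x]`). [OURS · L1 W4.5c · R4c (b6)] -/
theorem appLE_top_ne_zero_of_eq_comp_id [IsReduced X'] (M : GModel p q G ρ g₀) {π₁ : M.V ⟶ X'} (hπ : M.π = π₁ ≫ 𝟙 X')
    (U : X'.Opens) (hU : (⊤ : M.V.Opens) ≤ π₁ ⁻¹ᵁ U) {x : Γ(X', U)} (hx : x ≠ 0) : π₁.appLE U ⊤ hU x ≠ 0 := by
  haveI := M.isIntegral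
  haveI : Nonempty (⊤ : M.V.Opens) := ⟨⟨(inferInstance : Nonempty M.V).some, trivial⟩⟩
  intro h0
  exact hx (M.appLE_injective_of_eq_comp_id hπ U ⊤ hU (by rw [h0, map_zero]))

end Summit.ResolutionOfSingularities.ResolutionOfSingularities.Theorems.WildQuotientResolution.S1.GameFrame.GModel

end
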